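import Literature.Probability.LatticeModels.LeeYangFirstZeroStrip
import Literature.Probability.LatticeModels.CriticalTwoPointLower
import HarnessLib

/-!
# Near-critical Lee–Yang gap — stub S1e `stub_edgeAnalyticity`

Crux `NearCriticalLeeYangGap` (item stmt-CriticalPhenomena-4945), line `registered`, stub
`stub_edgeAnalyticity`: for `β` slightly below `β_c(3)` and every `w > 0` lying below all the first
Lee–Yang zeros `α₁(Λ_n, β) = JiangNewman.firstZero 3 (box 3 n) β` of the free cubes, the
magnetisation `h ↦ m(β,h) = magnetizationInField 3 β h` (`h ≥ 0`) extends holomorphically to the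
strip `{|Im z| < c·w}`.

**Proof.** Everything is the Literature theorem
`JiangNewman.exists_strip_extension_magnetization` (`LeeYangFirstZeroStrip.lean`; from the tree,
the named fact `JiangNewman.FirstZeroLimit` is NOT used): Lee–Yang and the definition of `α₁` make
the finite-volume free energies analytic, with volume-uniform Taylor bounds, on discs of radius
`< w` about every real field; compactness + Tannery + Friedli–Velenik Thm. 3.6 pass this to `f_β`;
the discs glue to the strip `{|Im h| < w/2}` (identity theorem); and `m(β,h) = f_β'(βh)`
(convexity brackets, GKS, `⟨σ₀⟩^∅ = ⟨σ₀⟩⁺` at `h > 0`), `m(β,0) = m*(β) = 0` for `β < β_c`.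
Constants: `c = 1/(2(β_c(3)+1))` (so `βc·w ≤ w/2` for `β < β_c(3)`), `β₀ = β_c(3)/2`, which is
`< β_c(3)` and `> 0` by `criticalBeta_pos_holds`.

## References

* J. Jiang, C. M. Newman, CPAM 77 (2024) 1224–1234, Thm. 1 [JiangNewman2023].
* T. D. Lee, C. N. Yang, Phys. Rev. 87 (1952) 410–419, Appendix II [LeeYang1952].
* S. Friedli, Y. Velenik, CUP 2017, Thm. 3.6, Prop. 3.29, Thm. 3.25, Def. 3.32 [FriedliVelenik2017].
-/

noncomputable section

namespace Summit.CriticalPhenomena.Ising3DConformalLimit.LeeYangGapNearCriticalLeeYangGap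

open Literature.Probability.LatticeModels

/-- **S1e — EdgeAnalyticity** (KNOWN): with `c = 1/(2(β_c(3)+1))` and `β₀ = β_c(3)/2`, for
`β ∈ [β₀, β_c(3))` and every `w > 0` with `w ≤ α₁(Λ_n,β)` for all `n`, `h ↦ m(β,h)` (`h ≥ 0`)
extends holomorphically to the strip `{|Im z| < c·w}` (Jiang–Newman-type analyticity of `f_β`
below the first Lee–Yang zeros of the free cubes about every real field, glued along the real axis,
and `m = ∂f_β/∂h`; `m*(β) = 0` below `β_c` by the definition of `β_c` and `m* ≥ 0`). -/
theorem stub_edgeAnalyticity :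
    ∃ c β₀ : ℝ, 0 < c ∧ β₀ < Literature.Probability.LatticeModels.criticalBeta 3 ∧
      ∀ β : ℝ, β₀ ≤ β → β < Literature.Probability.LatticeModels.criticalBeta 3 → ∀ w : ℝ, 0 < w →
        (∀ n : ℕ, w ≤ Literature.Probability.LatticeModels.JiangNewman.firstZero 3
          (Literature.Probability.LatticeModels.box 3 n) β) →
        ∃ F : ℂ → ℂ, DifferentiableOn ℂ F {z : ℂ | |z.im| < c * w} ∧
          ∀ h : ℝ, 0 ≤ h → F (h : ℂ) =
            ((Literature.Probability.LatticeModels.magnetizationInField 3 β h : ℝ) : ℂ) := by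
  have hβc : 0 < criticalBeta 3 := criticalBeta_pos_holds (d := 3) (by norm_num)
  refine ⟨1 / (2 * (criticalBeta 3 + 1)), criticalBeta 3 / 2, by positivity, by linarith, ?_⟩
  intro β hβ₀ hβc' w hw hwα
  have hβ : 0 < β := by linarith
  -- `m*(β) = 0` for `0 ≤ β < β_c` (`β_c` is an infimum, `m* ≥ 0` by GKS)
  have hm : spontaneousMagnetization 3 β = 0 := by
    refine le_antisymm (not_lt.1 fun hpos => not_le.2 hβc' ?_)
      (spontaneousMagnetization_nonneg_holds (d := 3) hβ.le)
    exact csInf_le ⟨0, fun _ hb => hb.1⟩ ⟨hβ.le, hpos⟩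
  refine JiangNewman.exists_strip_extension_magnetization (d := 3) (by norm_num) hβ hm hw hwα ?_
  -- `β · (c w) ≤ w / 2`
  have h1 : β / (criticalBeta 3 + 1) ≤ 1 := by
    rw [div_le_one (by linarith)]; linarith
  have h2 : β * (1 / (2 * (criticalBeta 3 + 1)) * w) = β / (criticalBeta 3 + 1) * (w / 2) := by
    field_simp
  rw [h2]
  nlinarith

end Summit.CriticalPhenomena.Ising3DConformalLimit.LeeYangGapNearCriticalLeeYangGap

end
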